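import Literature.Probability.Percolation.TwoClusterConditionalAssociationProofs
import Literature.Probability.Percolation.TwoSetConditionalAssociation
import Literature.Probability.Percolation.TwoClusterGibbsCovariance
import Literature.Probability.Percolation.KozmaNitzanHittable
import Literature.Probability.Percolation.KozmaNitzanPreFKG
import Literature.Probability.Percolation.KozmaNitzanClusterPropertyReal
import HarnessLib

/-!
# Kozma–Nitzan's Question 9 for two relays, I — the set-source form in the relay graph and the star dictionary

Support file (`--supports stmt-CriticalPhenomena-4575`), prover `prim-ineq-gen-7` (gen 8; memo
`prim-ineq-gen-7/PROOF-Q9-MIXED-CSH.md` §1).  No definitions, no named facts, no sorries.  Sequel: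
`…KNQuestion9Pair.lean` (the observer's graph: law of total probability over the open star of `o`).

Kozma–Nitzan, arXiv:2401.12397, QUESTION 9 (§5.5 p. 36): with `H = G − (edges at 0)` and `a ∈ A` the
minimiser of `P_H(a ↔ b)`, does the pre-FKG inequality (41) `P(0↔b, 0↔A) ≥ P(0↔A, a↔b)` hold?
Conditioning on the open star of `0` turns (41) into a statement about the relay graph `H` alone with a
SOURCE SET `S` (the neighbours of `0` reached directly): the "set-source form"
`P_H(S↔A, a ↔^S b) ≤ P_H(S↔b, S↔A)`, where `a ↔^S b` means `a ↔ b` or (`a ↔ S` and `S ↔ b`).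
THIS FILE proves the set-source form for `|A| = 2` (`KnQ9Pair.setSource_pair`): for `A = {c, k}` with
`P_H(c↔b) ≤ P_H(k↔b)`.  The G-level argument of Kozma–Nitzan's Theorem 1 / of the tree's `Q7Psi` needs the
minimiser of `P_G`, which `c` need not be; the proof here conditions in `H` on `{k ↮ c}` and uses
van den Berg–Häggström–Kahn's Theorem 1.5 (tree `BHK2006_twoClusterConditionalAssociation_holds`) twice,
with the BI-MONOTONE weight `1{S meets C_k}·1{S misses C_c}`.
[cite: KozmaNitzan2024, Question 9 (§5.5 p. 36), Thm. 1 (pp. 7–8)] [cite: VandenbergHaggstromKahn2005, Thm. 1.5 (p. 7)]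
-/

noncomputable section

namespace Summit.CriticalPhenomena.PercolationContinuityZ3.Theorems

open MeasureTheory Set Literature.Probability.LatticeModels Literature.Probability.Percolation
open Literature.Probability.Percolation.KNPreFKG
open Literature.Probability.Percolation.TwoSetConditionalAssociation (mem_of_reachable_of_closed)
open scoped Classical

namespace KnQ9Pair

variable {V : Type*} [Fintype V]

omit [Fintype V] in
/-- The family of edge sets of `k` that SEE the set `S`: `k ∈ S` or some edge meets `S`; `{k ↔ S} = {C_k ∈ hitFamily k S}`.
An upper family. [cite: VandenbergHaggstromKahn2005, §1 p. 3] -/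
theorem isUpperSet_hitFamily (k : V) (S : Set V) :
    IsUpperSet {C : Set (Sym2 V) | ∃ s ∈ S, s = k ∨ ∃ e ∈ C, s ∈ e} := by
  intro C C' hCC' hC
  obtain ⟨s, hs, h⟩ := hC
  rcases h with h | ⟨e, he, hse⟩
  · exact ⟨s, hs, Or.inl h⟩
  · exact ⟨s, hs, Or.inr ⟨e, hCC' he, hse⟩⟩

omit [Fintype V] in
/-- `{k ↔ S}` read off the open edge cluster of `k`. [cite: VandenbergHaggstromKahn2005, §1 p. 3] -/
theorem setOf_exists_reachable_eq (k : V) (S : Set V) :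
    {ω : BondConfig V | ∃ s ∈ S, (openGraph ω).Reachable k s} =
      {ω | openEdgeCluster ω k ∈ {C : Set (Sym2 V) | ∃ s ∈ S, s = k ∨ ∃ e ∈ C, s ∈ e}} := by
  ext ω
  simp only [mem_setOf_eq]
  refine exists_congr fun s => and_congr_right fun _ => ?_
  exact reachable_iff_exists_mem_openEdgeCluster ω k s

/-- **The two-cluster step.**  `D = {k ↮ c}`, `W = {k ↔ S} ∩ {c ↮ S}`.  If `μ(c↔b) ≤ μ(k↔b)` then
`μ(D ∩ W ∩ {c↔b}) ≤ μ(D ∩ W ∩ {k↔b})`: under `μ(·|D)` the weight `1_W` is increasing in `C_k` and decreasing in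
`C_c`, so (vdBHK Thm 1.5) it is positively correlated with `1{k↔b}` and negatively with `1{c↔b}`, and
`μ(D ∩ {k↔b}) − μ(D ∩ {c↔b}) = μ(k↔b) − μ(c↔b) ≥ 0`.
[cite: VandenbergHaggstromKahn2005, Thm. 1.5 (p. 7)] [cite: KozmaNitzan2024, Question 9 (p. 36)] -/
theorem twoCluster_step (w : Sym2 V → unitInterval) (S : Set V) (b c k : V) (hkc : k ≠ c)
    (hmin : (prodBernoulli w).real (openConn c b) ≤ (prodBernoulli w).real (openConn k b)) :
    (prodBernoulli w).real ({ω : BondConfig V | ¬ (openGraph ω).Reachable k c} ∩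
        ({ω | ∃ s ∈ S, (openGraph ω).Reachable k s} ∩ {ω | ∀ s ∈ S, ¬ (openGraph ω).Reachable c s}) ∩
          openConn c b) ≤
      (prodBernoulli w).real ({ω : BondConfig V | ¬ (openGraph ω).Reachable k c} ∩
        ({ω | ∃ s ∈ S, (openGraph ω).Reachable k s} ∩ {ω | ∀ s ∈ S, ¬ (openGraph ω).Reachable c s}) ∩
          openConn k b) := by
  classical
  set μ := prodBernoulli w with hμ
  set D : Set (BondConfig V) := {ω | ¬ (openGraph ω).Reachable k c} with hD
  set Hk : Set (BondConfig V) := {ω | ∃ s ∈ S, (openGraph ω).Reachable k s} with hHk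
  set Ac : Set (BondConfig V) := {ω | ∀ s ∈ S, ¬ (openGraph ω).Reachable c s} with hAc
  have hmeas : ∀ T : Set (BondConfig V), MeasurableSet T := fun _ => MeasurableSet.of_discrete
  have hne := fun (T : Set (BondConfig V)) => (measure_ne_top μ T)
  -- the families
  set 𝒰 : Set (Set (Sym2 V)) := {C | ∃ s ∈ S, s = k ∨ ∃ e ∈ C, s ∈ e} with h𝒰
  set 𝒬 : Set (Set (Sym2 V)) := disconnFamily c S with h𝒬
  set Wf : Set (Sym2 V) → Set (Sym2 V) → ℝ := fun Ck Cc => 𝒰.indicator 1 Ck * 𝒬.indicator 1 Cc with hWf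
  have hWf1 : ∀ Cc, Monotone fun Ck => Wf Ck Cc := fun Cc C C' hCC' =>
    mul_le_mul_of_nonneg_right (monotone_indicator_one_of_isUpperSet (isUpperSet_hitFamily k S) hCC')
      (indicator_nonneg (fun _ _ => zero_le_one) _)
  have hWf2 : ∀ Ck, Antitone fun Cc => Wf Ck Cc := fun Ck C C' hCC' =>
    mul_le_mul_of_nonneg_left (antitone_indicator_one_of_isLowerSet (isLowerSet_disconnFamily c S) hCC')
      (indicator_nonneg (fun _ _ => zero_le_one) _)
  set X1 : Set (Sym2 V) → Set (Sym2 V) → ℝ := fun Ck _ => (connFamily k b).indicator 1 Ck with hX1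
  set X2 : Set (Sym2 V) → Set (Sym2 V) → ℝ := fun _ Cc => -(connFamily c b).indicator 1 Cc with hX2
  have hX1a : ∀ Cc, Monotone fun Ck => X1 Ck Cc := fun _ =>
    monotone_indicator_one_of_isUpperSet (isUpperSet_connFamily k b)
  have hX1b : ∀ Ck, Antitone fun Cc => X1 Ck Cc := fun _ => antitone_const
  have hX2a : ∀ Cc, Monotone fun Ck => X2 Ck Cc := fun _ => monotone_const
  have hX2b : ∀ Ck, Antitone fun Cc => X2 Ck Cc := fun _ C C' hCC' =>
    neg_le_neg (monotone_indicator_one_of_isUpperSet (isUpperSet_connFamily c b) hCC')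
  -- pointwise identification of the integrands with event indicators
  have hW_ind : ∀ ω : BondConfig V, Wf (openEdgeCluster ω k) (openEdgeCluster ω c) = (Hk ∩ Ac).indicator 1 ω := by
    intro ω
    have e1 : 𝒰.indicator (1 : Set (Sym2 V) → ℝ) (openEdgeCluster ω k) = Hk.indicator 1 ω := by
      rw [congrFun (indicator_comp_openEdgeCluster 𝒰 k) ω, hHk, setOf_exists_reachable_eq k S]
    have e2 : 𝒬.indicator (1 : Set (Sym2 V) → ℝ) (openEdgeCluster ω c) = Ac.indicator 1 ω := by
      rw [congrFun (indicator_comp_openEdgeCluster 𝒬 c) ω, hAc, setOf_forall_not_reachable_eq c S]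
    simp only [hWf, e1, e2]
    exact congrFun (indicator_one_mul_indicator_one Hk Ac) ω
  have hX1_ind : ∀ ω : BondConfig V, X1 (openEdgeCluster ω k) (openEdgeCluster ω c) = (openConn k b).indicator 1 ω := by
    intro ω
    simp only [hX1]
    rw [congrFun (indicator_comp_openEdgeCluster (connFamily k b) k) ω, ← openConn_eq_setOf_connFamily]
  have hX2_ind : ∀ ω : BondConfig V, X2 (openEdgeCluster ω k) (openEdgeCluster ω c) = -(openConn c b).indicator 1 ω := by
    intro ω
    simp only [hX2]
    rw [congrFun (indicator_comp_openEdgeCluster (connFamily c b) c) ω, ← openConn_eq_setOf_connFamily]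
  -- the two applications of vdBHK Thm 1.5
  have B1 := BHK2006_twoClusterConditionalAssociation_holds V w k c Wf X1 hWf1 hWf2 hX1a hX1b hkc
  have B2 := BHK2006_twoClusterConditionalAssociation_holds V w k c Wf X2 hWf1 hWf2 hX2a hX2b hkc
  simp only [hW_ind, hX1_ind, hX2_ind, mul_neg, integral_neg] at B1 B2
  rw [setIntegral_indicator_one_eq, setIntegral_indicator_one_eq] at B1 B2
  rw [show (fun ω => (Hk ∩ Ac).indicator (1 : BondConfig V → ℝ) ω * (openConn k b).indicator 1 ω) =
      (Hk ∩ Ac ∩ openConn k b).indicator 1 from indicator_one_mul_indicator_one _ _,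
    setIntegral_indicator_one_eq] at B1
  rw [show (fun ω => (Hk ∩ Ac).indicator (1 : BondConfig V → ℝ) ω * (openConn c b).indicator 1 ω) =
      (Hk ∩ Ac ∩ openConn c b).indicator 1 from indicator_one_mul_indicator_one _ _,
    setIntegral_indicator_one_eq] at B2
  -- the marginals: μ(D ∩ {k↔b}) − μ(D ∩ {c↔b}) = μ(k↔b) − μ(c↔b) ≥ 0
  have hsplit : ∀ x : V, μ.real (openConn x b) = μ.real (openConn x b ∩ D) + μ.real (openConn x b \ D) :=
    fun x => (measureReal_inter_add_sdiff (hmeas D) (hne _)).symm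
  have hcompl : openConn k b \ D = openConn c b \ D := by
    ext ω
    simp only [mem_sdiff, hD, mem_setOf_eq, not_not, openConn]
    constructor
    · rintro ⟨hkb, hkc'⟩; exact ⟨hkc'.symm.trans hkb, hkc'⟩
    · rintro ⟨hcb, hkc'⟩; exact ⟨hkc'.trans hcb, hkc'⟩
  have hmarg : μ.real (D ∩ openConn c b) ≤ μ.real (D ∩ openConn k b) := by
    rw [inter_comm D, inter_comm D]
    have h1 := hsplit k
    have h2 := hsplit c
    rw [hcompl] at h1
    linarith
  -- combine
  have hWnn : 0 ≤ μ.real (D ∩ (Hk ∩ Ac)) := measureReal_nonneg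
  have key : μ.real D * μ.real (D ∩ (Hk ∩ Ac ∩ openConn c b)) ≤ μ.real D * μ.real (D ∩ (Hk ∩ Ac ∩ openConn k b)) := by
    nlinarith [B1, B2, hmarg, hWnn]
  by_cases hD0 : μ.real D = 0
  · have h2 : μ.real (D ∩ (Hk ∩ Ac ∩ openConn c b)) ≤ μ.real D := measureReal_mono inter_subset_left (hne _)
    rw [hD0] at h2
    have h3 : μ.real (D ∩ (Hk ∩ Ac ∩ openConn c b)) = 0 := le_antisymm h2 measureReal_nonneg
    rw [show D ∩ (Hk ∩ Ac) ∩ openConn c b = D ∩ (Hk ∩ Ac ∩ openConn c b) by rw [inter_assoc], h3]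
    exact measureReal_nonneg
  · have hDpos : 0 < μ.real D := lt_of_le_of_ne measureReal_nonneg (Ne.symm hD0)
    rw [show D ∩ (Hk ∩ Ac) ∩ openConn c b = D ∩ (Hk ∩ Ac ∩ openConn c b) by rw [inter_assoc],
      show D ∩ (Hk ∩ Ac) ∩ openConn k b = D ∩ (Hk ∩ Ac ∩ openConn k b) by rw [inter_assoc]]
    exact le_of_mul_le_mul_left key hDpos

/-- **The set-source form of Question 9 for two relays.**  In a weighted graph (the relay graph `H`) let `S` be a
set of vertices (the source set), `b` a target and `c ≠ k` two relays with `μ(c↔b) ≤ μ(k↔b)`.  Write `S ↔ u` for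
`∃ s ∈ S, s ↔ u`.  Then
`μ({c ↔ b ∨ (S ↔ c ∧ S ↔ b)} ∩ {S ↔ c ∨ S ↔ k}) ≤ μ({S ↔ b} ∩ {S ↔ c ∨ S ↔ k})`
— the pre-FKG inequality (41) at a source glued to `S`, for the designated relay `c` (the minimiser BEFORE gluing).
On `{S ↔ c}` the two events coincide; off it they are `{S↔k, S↮c, c↔b}` resp. `⊇ {S↔k, S↮c, k↔b}`, both inside
`{k ↮ c}`, and `twoCluster_step` compares them. [cite: KozmaNitzan2024, Question 9 (§5.5 p. 36), Conjecture 6 (§5.3 p. 34)] -/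
theorem setSource_pair (w : Sym2 V → unitInterval) (S : Set V) (b c k : V) (hkc : k ≠ c)
    (hmin : (prodBernoulli w).real (openConn c b) ≤ (prodBernoulli w).real (openConn k b)) :
    (prodBernoulli w).real
        {ω : BondConfig V | ((openGraph ω).Reachable c b ∨
            ((∃ s ∈ S, (openGraph ω).Reachable s c) ∧ ∃ s ∈ S, (openGraph ω).Reachable s b)) ∧
          ((∃ s ∈ S, (openGraph ω).Reachable s c) ∨ ∃ s ∈ S, (openGraph ω).Reachable s k)} ≤
      (prodBernoulli w).real
        {ω : BondConfig V | (∃ s ∈ S, (openGraph ω).Reachable s b) ∧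
          ((∃ s ∈ S, (openGraph ω).Reachable s c) ∨ ∃ s ∈ S, (openGraph ω).Reachable s k)} := by
  classical
  set μ := prodBernoulli w with hμ
  have hmeas : ∀ T : Set (BondConfig V), MeasurableSet T := fun _ => MeasurableSet.of_discrete
  have hne := fun (T : Set (BondConfig V)) => (measure_ne_top μ T)
  set EL : Set (BondConfig V) := {ω | ((openGraph ω).Reachable c b ∨
      ((∃ s ∈ S, (openGraph ω).Reachable s c) ∧ ∃ s ∈ S, (openGraph ω).Reachable s b)) ∧
      ((∃ s ∈ S, (openGraph ω).Reachable s c) ∨ ∃ s ∈ S, (openGraph ω).Reachable s k)} with hEL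
  set ER : Set (BondConfig V) := {ω | (∃ s ∈ S, (openGraph ω).Reachable s b) ∧
      ((∃ s ∈ S, (openGraph ω).Reachable s c) ∨ ∃ s ∈ S, (openGraph ω).Reachable s k)} with hER
  set CS : Set (BondConfig V) := {ω | ∃ s ∈ S, (openGraph ω).Reachable s c} with hCS
  set D : Set (BondConfig V) := {ω | ¬ (openGraph ω).Reachable k c} with hD
  set Hk : Set (BondConfig V) := {ω | ∃ s ∈ S, (openGraph ω).Reachable k s} with hHk
  set Ac : Set (BondConfig V) := {ω | ∀ s ∈ S, ¬ (openGraph ω).Reachable c s} with hAc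
  -- on `{S ↔ c}` the two events coincide
  have hin : EL ∩ CS = ER ∩ CS := by
    ext ω
    simp only [hEL, hER, hCS, mem_inter_iff, mem_setOf_eq]
    constructor
    · rintro ⟨⟨h1, _⟩, hc⟩
      refine ⟨⟨?_, Or.inl hc⟩, hc⟩
      rcases h1 with hcb | ⟨_, hb⟩
      · obtain ⟨s, hs, hsc⟩ := hc
        exact ⟨s, hs, hsc.trans hcb⟩
      · exact hb
    · rintro ⟨⟨hb, _⟩, hc⟩
      exact ⟨⟨Or.inr ⟨hc, hb⟩, Or.inl hc⟩, hc⟩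
  -- off `{S ↔ c}`
  have hL : EL \ CS ⊆ D ∩ (Hk ∩ Ac) ∩ openConn c b := by
    rintro ω ⟨⟨h1, h2⟩, hc⟩
    have hcS : ∀ s ∈ S, ¬ (openGraph ω).Reachable c s := fun s hs h => hc ⟨s, hs, h.symm⟩
    have hk : ∃ s ∈ S, (openGraph ω).Reachable k s := by
      rcases h2 with h | ⟨s, hs, hsk⟩
      · exact absurd h hc
      · exact ⟨s, hs, hsk.symm⟩
    refine ⟨⟨?_, hk, hcS⟩, ?_⟩
    · intro hkc'
      obtain ⟨s, hs, hks⟩ := hk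
      exact hcS s hs (hkc'.symm.trans hks)
    · rcases h1 with hcb | ⟨h, _⟩
      · exact hcb
      · exact absurd h hc
  have hR : D ∩ (Hk ∩ Ac) ∩ openConn k b ⊆ ER \ CS := by
    rintro ω ⟨⟨_, ⟨s, hs, hks⟩, hcS⟩, hkb⟩
    refine ⟨⟨⟨s, hs, hks.symm.trans hkb⟩, Or.inr ⟨s, hs, hks.symm⟩⟩, ?_⟩
    rintro ⟨s', hs', hs'c⟩
    exact hcS s' hs' hs'c.symm
  have step := twoCluster_step w S b c k hkc hmin
  have e1 := measureReal_inter_add_sdiff (μ := μ) (s := EL) (hmeas CS) (hne _)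
  have e2 := measureReal_inter_add_sdiff (μ := μ) (s := ER) (hmeas CS) (hne _)
  have m1 := measureReal_mono (μ := μ) hL (hne _)
  have m2 := measureReal_mono (μ := μ) hR (hne _)
  rw [hin] at e1
  linarith

/-! ### From the observer's graph to the relay graph: the open star of `o` -/

omit [Fintype V] in
/-- No pair containing `o` lies in `wireSet {o}ᶜ`; in particular `o` is isolated in `ω ∩ wireSet {o}ᶜ`. [folklore] -/
theorem not_adj_inter_wireSet (ω : BondConfig V) (o z : V) :
    ¬ (openGraph (ω ∩ wireSet ({o}ᶜ : Set V))).Adj o z := by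
  intro h
  rw [openGraph_adj, mem_inter_iff, mk_mem_wireSet_iff] at h
  exact h.1.2.1 rfl

omit [Fintype V] in
/-- `o` reaches only itself in `ω ∩ wireSet {o}ᶜ`. [folklore] -/
theorem reachable_inter_wireSet_self_iff (ω : BondConfig V) (o z : V) :
    (openGraph (ω ∩ wireSet ({o}ᶜ : Set V))).Reachable o z ↔ z = o := by
  constructor
  · intro h
    have hcl : ∀ ⦃a b' : V⦄, a ∈ ({o} : Set V) → (openGraph (ω ∩ wireSet ({o}ᶜ : Set V))).Adj a b' →
        b' ∈ ({o} : Set V) := by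
      intro a b' ha hab
      rw [mem_singleton_iff] at ha
      subst ha
      exact absurd hab (not_adj_inter_wireSet ω a b')
    exact mem_singleton_iff.1 (mem_of_reachable_of_closed hcl (mem_singleton o) h)
  · rintro rfl
    exact SimpleGraph.Reachable.refl _

omit [Fintype V] in
/-- **The star dictionary.**  If the open pairs at `o` are exactly the pairs `s(o, s)`, `s ∈ Σ`, then with
`ω' = ω ∩ wireSet {o}ᶜ` (the configuration seen by the relay graph) and `J z :⇔ z = o ∨ Σ ↔_{ω'} z`:
`x ↔_ω y  ⟺  x ↔_{ω'} y ∨ (J x ∧ J y)` (the open cluster of `o` is `{o}` together with the `ω'`-clusters of `Σ`). [folklore] -/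
theorem reachable_iff_of_star (ω : BondConfig V) (o : V) (Sig : Set V) (hoS : o ∉ Sig)
    (hstar : ∀ s : V, s ≠ o → (s(o, s) ∈ ω ↔ s ∈ Sig)) (x y : V) :
    (openGraph ω).Reachable x y ↔
      (openGraph (ω ∩ wireSet ({o}ᶜ : Set V))).Reachable x y ∨
        ((x = o ∨ ∃ s ∈ Sig, (openGraph (ω ∩ wireSet ({o}ᶜ : Set V))).Reachable s x) ∧
          (y = o ∨ ∃ s ∈ Sig, (openGraph (ω ∩ wireSet ({o}ᶜ : Set V))).Reachable s y)) := by
  set ω' : BondConfig V := ω ∩ wireSet ({o}ᶜ : Set V) with hω'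
  -- adjacency facts
  have hadj' : ∀ {a b' : V}, (openGraph ω).Adj a b' → a ≠ o → b' ≠ o → (openGraph ω').Adj a b' := by
    intro a b' h hao hbo
    rw [openGraph_adj] at h ⊢
    exact ⟨⟨h.1, mk_mem_wireSet_iff.2 ⟨hao, hbo, h.2⟩⟩, h.2⟩
  have hadjo : ∀ {z : V}, (openGraph ω).Adj o z → z ∈ Sig := by
    intro z h
    rw [openGraph_adj] at h
    exact (hstar z (Ne.symm h.2)).1 h.1
  have hadjo' : ∀ {z : V}, z ∈ Sig → (openGraph ω).Adj o z := by
    intro z hz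
    have hzo : z ≠ o := fun h => hoS (h ▸ hz)
    rw [openGraph_adj]
    exact ⟨(hstar z hzo).2 hz, Ne.symm hzo⟩
  have hmono : ∀ {a b' : V}, (openGraph ω').Reachable a b' → (openGraph ω).Reachable a b' := by
    intro a b' h
    refine h.mono ?_
    intro p q hpq
    rw [openGraph_adj] at hpq ⊢
    exact ⟨hpq.1.1, hpq.2⟩
  constructor
  · intro h
    -- the target set is closed under `ω`-adjacency
    set M : Set V := {y | (openGraph ω').Reachable x y ∨
        ((x = o ∨ ∃ s ∈ Sig, (openGraph ω').Reachable s x) ∧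
          (y = o ∨ ∃ s ∈ Sig, (openGraph ω').Reachable s y))} with hM
    have hcl : ∀ ⦃a b' : V⦄, a ∈ M → (openGraph ω).Adj a b' → b' ∈ M := by
      intro a b' ha hab
      by_cases hao : a = o
      · subst hao
        have hb' : b' ∈ Sig := hadjo hab
        have hJx : x = a ∨ ∃ s ∈ Sig, (openGraph ω').Reachable s x := by
          rcases ha with h1 | ⟨h1, _⟩
          · exact Or.inl ((reachable_inter_wireSet_self_iff ω a x).1 h1.symm)
          · exact h1
        exact Or.inr ⟨hJx, Or.inr ⟨b', hb', SimpleGraph.Reachable.refl _⟩⟩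
      · by_cases hbo : b' = o
        · subst hbo
          have haS : a ∈ Sig := hadjo hab.symm
          have hJx : x = b' ∨ ∃ s ∈ Sig, (openGraph ω').Reachable s x := by
            rcases ha with h1 | ⟨h1, _⟩
            · exact Or.inr ⟨a, haS, h1.symm⟩
            · exact h1
          exact Or.inr ⟨hJx, Or.inl rfl⟩
        · have hab' : (openGraph ω').Adj a b' := hadj' hab hao hbo
          rcases ha with h1 | ⟨h1, h2⟩
          · exact Or.inl (h1.trans hab'.reachable)
          · refine Or.inr ⟨h1, ?_⟩
            rcases h2 with h2 | ⟨s, hs, hsa⟩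
            · exact absurd h2 hao
            · exact Or.inr ⟨s, hs, hsa.trans hab'.reachable⟩
    have hx : x ∈ M := Or.inl (SimpleGraph.Reachable.refl _)
    exact mem_of_reachable_of_closed hcl hx h
  · rintro (h | ⟨hx, hy⟩)
    · exact hmono h
    · have hJ : ∀ {z : V}, (z = o ∨ ∃ s ∈ Sig, (openGraph ω').Reachable s z) → (openGraph ω).Reachable o z := by
        intro z hz
        rcases hz with rfl | ⟨s, hs, hsz⟩
        · exact SimpleGraph.Reachable.refl _
        · exact (hadjo' hs).reachable.trans (hmono hsz)
      exact (hJ hx).symm.trans (hJ hy)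

end KnQ9Pair

end Summit.CriticalPhenomena.PercolationContinuityZ3.Theorems
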